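import Mathlib.Topology.Covering.Quotient
import HarnessLib

/-!
# The covering space associated with a `G`-set: `(E × S)/G → X` for a quotient covering map
# `E → X` of a free `G`-action (Hatcher §1.3, p. 70 / Exercise 1.3.24; the «Borel construction»)

Topic `Literature/Topology/CoveringSpaces`.  Let `f : E → X` be a QUOTIENT COVERING MAP for the
action of a group `G` on `E` (Mathlib's `IsQuotientCoveringMap`, J. Xu: `f` is a quotient map whose
fibres are the `G`-orbits, `G` acts by homeomorphisms, and every point of `E` has a neighbourhood
disjoint from all its non-trivial translates) — e.g. the universal cover `X̃ → X` with its deck action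
of `π₁(X, x₀)` (the tree's `UniversalCover.isQuotientCoveringMap_proj`).  For ANY `G`-set `S` (with the
discrete topology) the ASSOCIATED SPACE

  `E ×_G S := (E × S)/G`  (diagonal action `g • (e, s) = (g • e, g • s)`, Mathlib `Prod.mulAction`)

projects to `X` by `[(e, s)] ↦ f e`, and this projection is a COVERING MAP with fibre `S`: over
`V = f(U)`, `U` a neighbourhood disjoint from its translates, the preimage is the disjoint union over
`s ∈ S` of the sheets `[(U, s)]`, each mapped homeomorphically onto `V` (Hatcher, *Algebraic Topology*
(2002), §1.3 p. 70: «for an action of `π₁(X,x₀)` on a set `F` … the quotient `X̃ ×_{π₁} F → X` is a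
covering space with fibre `F`»; this is the essential surjectivity of the fibre functor in the
classification of covering spaces, Thm. 1.38 / Ex. 24, and for `S = G/H` it is the intermediate
cover `X̃/H → X` of Prop. 1.36 for a NOT necessarily normal subgroup `H`).

* `AssocSpace G E S`, `assocMk`, `assocProj` — the construction;
* `assocMk_smul`, `assocMk_eq_iff`, `assocProj_assocMk`, `continuous_assocMk`, `isOpenMap_assocMk`,
  `surjective_assocMk`, `continuous_assocProj`;
* **`isCoveringMap_assocProj`** — `E ×_G S → X` is a covering map;
* **`assocFibreEquiv hf e₀ : (assocProj hf S)⁻¹{f e₀} ≃ S`** — the fibre over `f e₀` is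
  `S` (`[(e, s)] ↦ g⁻¹ • s` for the unique `g` with `e = g • e₀`), with `assocFibreEquiv_symm_apply`,
  `assocFibreEquiv_assocMk_smul` (`[(g • e₀, s)] ↦ g⁻¹ • s`).

Everything is proved; the definitions (`AssocSpace`, `assocMk`, `assocProj`, `assocFibreEquiv`) have
bodies; no named facts.  Written as half (C) of the abc-iut cell's campaign-L row G-L4t14-R1 (the
topological Galois correspondence for covering spaces; partner files by abc-iut-w5-d144), but purely
classical topology.

## References

* A. Hatcher, *Algebraic Topology*, CUP 2002, §1.3 p. 70 (covers from `π₁`-sets), Prop. 1.36,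
  Thm. 1.38, Exercise 1.3.24. [HatcherAT2002]
-/

noncomputable section

open Set Filter Topology MulAction Function Bundle

namespace Literature.Topology.CoveringSpaces

universe u v w

variable {G : Type u} {E : Type v} {X : Type*} [Group G] [MulAction G E]

/-! ### The associated space `E ×_G S` -/

section Space

variable {S : Type w} [MulAction G S]

variable (G E S) in
/-- **The space `E ×_G S = (E × S)/G` associated with a `G`-space `E` and a `G`-set `S`** (orbit space
of the diagonal action). [cite: HatcherAT2002, §1.3 p. 70] -/
abbrev AssocSpace : Type (max v w) := orbitRel.Quotient G (E × S)

/-- The class `[(e, s)] ∈ E ×_G S`. [cite: HatcherAT2002, §1.3 p. 70] -/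
def assocMk (p : E × S) : AssocSpace G E S := Quotient.mk (orbitRel G (E × S)) p

/-- `assocMk` is surjective. [cite: HatcherAT2002, §1.3 p. 70] -/
theorem surjective_assocMk : Surjective (assocMk : E × S → AssocSpace G E S) :=
  Quotient.mk_surjective

/-- Equality of classes: `[(e, s)] = [(e', s')] ↔ ∃ g, g • e' = e ∧ g • s' = s`. [cite: HatcherAT2002, §1.3 p. 70] -/
theorem assocMk_eq_iff {e e' : E} {s s' : S} :
    (assocMk (e, s) : AssocSpace G E S) = assocMk (e', s') ↔ ∃ g : G, g • e' = e ∧ g • s' = s := by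
  rw [assocMk, assocMk, Quotient.eq, orbitRel_apply, mem_orbit_iff]
  constructor
  · rintro ⟨g, hg⟩
    exact ⟨g, (Prod.ext_iff.1 hg).1, (Prod.ext_iff.1 hg).2⟩
  · rintro ⟨g, h1, h2⟩
    exact ⟨g, Prod.ext h1 h2⟩

/-- The diagonal action is invisible in the quotient: `[(g • e, g • s)] = [(e, s)]`. [cite: HatcherAT2002, §1.3 p. 70] -/
theorem assocMk_smul (g : G) (e : E) (s : S) :
    (assocMk (g • e, g • s) : AssocSpace G E S) = assocMk (e, s) :=
  assocMk_eq_iff.2 ⟨g, rfl, rfl⟩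

/-- Moving the group element to the other factor: `[(g • e, s)] = [(e, g⁻¹ • s)]`. [cite: HatcherAT2002, §1.3 p. 70] -/
theorem assocMk_smul_left (g : G) (e : E) (s : S) :
    (assocMk (g • e, s) : AssocSpace G E S) = assocMk (e, g⁻¹ • s) := by
  conv_lhs => rw [← smul_inv_smul g s]
  exact assocMk_smul g e (g⁻¹ • s)

/-- Over a set `U` disjoint from its non-trivial translates, `[(u, s)] = [(u', s')]` with `u, u' ∈ U`
forces `u = u'` and `s = s'`. [cite: HatcherAT2002, §1.3 p. 70] -/
theorem assocMk_injOn_prod {U : Set E} (hU : ∀ g : G, ((g • ·) '' U ∩ U).Nonempty → g = 1) :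
    InjOn (assocMk : E × S → AssocSpace G E S) (U ×ˢ univ) := by
  rintro ⟨u, s⟩ ⟨hu, -⟩ ⟨u', s'⟩ ⟨hu', -⟩ h
  obtain ⟨g, hgu, hgs⟩ := assocMk_eq_iff.1 h
  have hg : g = 1 := hU g ⟨u, ⟨u', hu', hgu⟩, hu⟩
  subst hg
  rw [one_smul] at hgu hgs
  rw [hgu, hgs]

section Topology

variable [TopologicalSpace E] [TopologicalSpace S]

/-- `assocMk` is continuous. [cite: HatcherAT2002, §1.3 p. 70] -/
theorem continuous_assocMk : Continuous (assocMk : E × S → AssocSpace G E S) := continuous_quot_mk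

/-- `assocMk` is an open map when `G` acts on `E` by homeomorphisms and `S` is discrete (quotient by a
group action by homeomorphisms). [cite: HatcherAT2002, §1.3 p. 70] -/
theorem isOpenMap_assocMk [ContinuousConstSMul G E] [DiscreteTopology S] :
    IsOpenMap (assocMk : E × S → AssocSpace G E S) := by
  haveI : ContinuousConstSMul G S := ⟨fun _ ↦ continuous_of_discreteTopology⟩
  exact isOpenMap_quotient_mk'_mul

end Topology

end Space

/-! ### The projection `E ×_G S → X` -/

section Proj

variable [TopologicalSpace E] [TopologicalSpace X] {f : E → X} (hf : IsQuotientCoveringMap f G)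
  {S : Type w} [MulAction G S]
include hf

variable (S) in
/-- **The projection `E ×_G S → X`, `[(e, s)] ↦ f e`** (well defined as `f` is constant on orbits), for
a quotient covering map `f` of the `G`-action on `E`. [cite: HatcherAT2002, §1.3 p. 70] -/
def assocProj : AssocSpace G E S → X :=
  Quotient.lift (fun p : E × S ↦ f p.1) fun a b (h : a ∈ orbit G b) ↦ by
    obtain ⟨g, rfl⟩ := h
    exact hf.map_smul g

/-- The projection on classes. [cite: HatcherAT2002, §1.3 p. 70] -/
@[simp] theorem assocProj_assocMk (e : E) (s : S) : assocProj hf S (assocMk (e, s)) = f e := rfl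

/-- The projection is continuous. [cite: HatcherAT2002, §1.3 p. 70] -/
theorem continuous_assocProj [TopologicalSpace S] : Continuous (assocProj hf S) :=
  continuous_quot_lift _ (hf.isCoveringMap.continuous.comp continuous_fst)

/-- The projection is surjective. [cite: HatcherAT2002, §1.3 p. 70] -/
theorem surjective_assocProj [Nonempty S] : Surjective (assocProj hf S) := fun x ↦ by
  obtain ⟨e, rfl⟩ := hf.surjective x
  exact ⟨assocMk (e, Classical.arbitrary S), rfl⟩

/-! ### Sheets over a neighbourhood disjoint from its translates -/

section Sheets

variable {U : Set E}

omit [MulAction G S] in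
/-- `f` is injective on a set `U` disjoint from its non-trivial translates. [cite: HatcherAT2002, §1.3 p. 70] -/
theorem injOn_of_disjoint (hU : ∀ g : G, ((g • ·) '' U ∩ U).Nonempty → g = 1) : InjOn f U := by
  intro u hu u' hu' h
  obtain ⟨g, hg⟩ := mem_orbit_iff.1 (hf.apply_eq_iff_mem_orbit.1 h)
  have : g = 1 := hU g ⟨u, ⟨u', hu', hg⟩, hu⟩
  subst this
  rw [← hg, one_smul]

/-- Every class over `f(U)` has a representative in `U × S`. [cite: HatcherAT2002, §1.3 p. 70] -/
theorem exists_rep_of_mem (q : AssocSpace G E S) (hq : assocProj hf S q ∈ f '' U) :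
    ∃ u ∈ U, ∃ s : S, q = assocMk (u, s) := by
  obtain ⟨⟨e, t⟩, rfl⟩ := surjective_assocMk q
  obtain ⟨u, hu, hfu⟩ := hq
  have hfu' : f e = f u := by rw [hfu]; rfl
  obtain ⟨g, hg⟩ := mem_orbit_iff.1 (hf.apply_eq_iff_mem_orbit.1 hfu')
  refine ⟨u, hu, g⁻¹ • t, ?_⟩
  rw [← assocMk_smul_left, hg]

/-- **The trivialization of `E ×_G S → X` over `V = f(U)`**, `U` open and disjoint from its non-trivial
translates: the sheets `[(U, s)]`, `s ∈ S`, are open, pairwise disjoint, exhaust the preimage of `V`,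
and each maps homeomorphically onto `V`. [cite: HatcherAT2002, §1.3 p. 70] -/
theorem exists_trivialization [TopologicalSpace S] [DiscreteTopology S] [Nonempty S] (hUo : IsOpen U)
    (hU : ∀ g : G, ((g • ·) '' U ∩ U).Nonempty → g = 1) :
    ∃ t : Trivialization S (assocProj hf S), t.baseSet = f '' U := by
  haveI : ContinuousConstSMul G E := hf.toContinuousConstSMul
  haveI : Nonempty (X → AssocSpace G E S) :=
    ⟨fun x ↦ assocMk (surjInv hf.surjective x, Classical.arbitrary S)⟩
  have hfo : IsOpenMap f := hf.isOpenQuotientMap.isOpenMap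
  -- the sheets
  let sh : S → Set (AssocSpace G E S) := fun s ↦ assocMk '' (U ×ˢ {s})
  have hsh_open : ∀ s, IsOpen (sh s) := fun s ↦
    isOpenMap_assocMk _ (hUo.prod (isOpen_discrete _))
  refine ⟨(hfo U hUo).trivializationDiscrete sh (f '' U) ?_ ?_ ?_ ?_ ?_, ?_⟩
  · -- openness of `W ⊆ V` is detected on each sheet
    intro s W hWV
    constructor
    · intro hW
      exact (hW.preimage (continuous_assocProj hf)).inter (hsh_open s)
    · intro hW
      -- pull back along `u ↦ [(u, s)]`
      have hι : Continuous fun u : E ↦ (assocMk (u, s) : AssocSpace G E S) :=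
        continuous_assocMk.comp (Continuous.prodMk_left s)
      have hopen : IsOpen (U ∩ f ⁻¹' W) := by
        have h1 : IsOpen ((fun u : E ↦ (assocMk (u, s) : AssocSpace G E S)) ⁻¹'
            (assocProj hf S ⁻¹' W ∩ sh s) ∩ U) := (hW.preimage hι).inter hUo
        have h2 : (fun u : E ↦ (assocMk (u, s) : AssocSpace G E S)) ⁻¹'
            (assocProj hf S ⁻¹' W ∩ sh s) ∩ U = U ∩ f ⁻¹' W := by
          ext u
          simp only [mem_inter_iff, mem_preimage, assocProj_assocMk]
          constructor
          · rintro ⟨⟨hW, -⟩, hu⟩; exact ⟨hu, hW⟩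
          · rintro ⟨hu, hW⟩; exact ⟨⟨hW, ⟨(u, s), ⟨hu, rfl⟩, rfl⟩⟩, hu⟩
        rwa [h2] at h1
      have hWeq : W = f '' (U ∩ f ⁻¹' W) := by
        apply Subset.antisymm
        · intro x hx
          obtain ⟨u, hu, rfl⟩ := hWV hx
          exact ⟨u, ⟨hu, hx⟩, rfl⟩
        · rintro _ ⟨u, ⟨-, hu⟩, rfl⟩; exact hu
      rw [hWeq]
      exact hfo _ hopen
  · -- injectivity of the projection on each sheet
    rintro s _ ⟨⟨u, s₁⟩, ⟨hu, rfl : s₁ = s⟩, rfl⟩ _ ⟨⟨u', s₂⟩, ⟨hu', rfl : s₂ = s₁⟩, rfl⟩ h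
    have huU : u ∈ U := hu
    have hu'U : u' ∈ U := hu'
    have h' : f u = f u' := h
    cases injOn_of_disjoint hf hU huU hu'U h'
    rfl
  · -- each sheet maps onto `V`
    rintro s x ⟨u, hu, rfl⟩
    exact ⟨assocMk (u, s), ⟨(u, s), ⟨hu, rfl⟩, rfl⟩, rfl⟩
  · -- the sheets are pairwise disjoint
    intro s s' hss'
    refine disjoint_left.2 ?_
    rintro _ ⟨⟨u, s₁⟩, ⟨hu, rfl : s₁ = s⟩, rfl⟩ ⟨⟨u', s₂⟩, ⟨hu', rfl : s₂ = s'⟩, h⟩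
    have := assocMk_injOn_prod (S := S) hU ⟨hu', mem_univ _⟩ ⟨hu, mem_univ _⟩ h
    exact hss' (Prod.ext_iff.1 this).2.symm
  · -- the sheets exhaust the preimage of `V`
    intro q hq
    obtain ⟨u, hu, s, rfl⟩ := exists_rep_of_mem hf q hq
    exact mem_iUnion.2 ⟨s, (u, s), ⟨hu, rfl⟩, rfl⟩
  · rfl

end Sheets

/-- **`E ×_G S → X` is a covering map** with fibre `S`, for every `G`-set `S` (discrete topology).
[cite: HatcherAT2002, §1.3 p. 70, Thm. 1.38] -/
theorem isCoveringMap_assocProj [TopologicalSpace S] [DiscreteTopology S] :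
    IsCoveringMap (assocProj hf S) := by
  rcases isEmpty_or_nonempty S with hS | hS
  · haveI : IsEmpty (AssocSpace G E S) := by
      refine ⟨fun q ↦ ?_⟩
      obtain ⟨⟨-, s⟩, -⟩ := surjective_assocMk q
      exact hS.false s
    exact IsCoveringMap.of_isEmpty _
  -- a trivialization around every point of `X`
  have key : ∀ x : X, ∃ t : Trivialization S (assocProj hf S), x ∈ t.baseSet := by
    intro x
    obtain ⟨e, rfl⟩ := hf.surjective x
    obtain ⟨U, hUe, hU⟩ := hf.disjoint e
    obtain ⟨t, ht⟩ := exists_trivialization hf (S := S) (U := interior U) isOpen_interior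
      (fun g hg ↦ hU g (hg.mono (inter_subset_inter (image_mono interior_subset) interior_subset)))
    exact ⟨t, by rw [ht]; exact ⟨e, mem_interior_iff_mem_nhds.2 hUe, rfl⟩⟩
  choose t ht using key
  exact IsCoveringMap.mk (assocProj hf S) (fun _ ↦ S) t ht

/-! ### The fibre over `f e₀` is `S` -/

/-- **The fibre of `E ×_G S → X` over `f e₀` is `S`**: `[(e, s)] ↦ g⁻¹ • s` for the unique `g ∈ G`
with `e = g • e₀` (the action on `E` is free and transitive on fibres), inverse `s ↦ [(e₀, s)]`.
[cite: HatcherAT2002, §1.3 p. 70] -/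
def assocFibreEquiv (e₀ : E) : assocProj hf S ⁻¹' {f e₀} ≃ S := by
  classical
  refine (Equiv.ofBijective (fun s : S ↦ (⟨assocMk (e₀, s), rfl⟩ : assocProj hf S ⁻¹' {f e₀}))
    ⟨fun s s' h ↦ ?_, fun q ↦ ?_⟩).symm
  · have h' : (assocMk (e₀, s) : AssocSpace G E S) = assocMk (e₀, s') := congrArg Subtype.val h
    obtain ⟨g, hg, hgs⟩ := assocMk_eq_iff.1 h'
    haveI := hf.isCancelSMul
    have : g = 1 := IsCancelSMul.right_cancel g 1 e₀ (by rw [hg, one_smul])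
    subst this
    rw [← hgs, one_smul]
  · obtain ⟨⟨e, t⟩, hq⟩ := surjective_assocMk q.1
    have he : f e = f e₀ := by
      have := q.2
      rw [mem_preimage, mem_singleton_iff, ← hq] at this
      exact this
    obtain ⟨g, hg⟩ := mem_orbit_iff.1 (hf.apply_eq_iff_mem_orbit.1 he)
    refine ⟨g⁻¹ • t, Subtype.ext ?_⟩
    change (assocMk (e₀, g⁻¹ • t) : AssocSpace G E S) = q.1
    rw [← hq, ← assocMk_smul_left, hg]

/-- The inverse of the fibre equivalence is `s ↦ [(e₀, s)]`. [cite: HatcherAT2002, §1.3 p. 70] -/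
@[simp] theorem assocFibreEquiv_symm_apply (e₀ : E) (s : S) :
    (((assocFibreEquiv hf e₀).symm s : assocProj hf S ⁻¹' {f e₀}) : AssocSpace G E S) =
      assocMk (e₀, s) := rfl

/-- The fibre equivalence on `[(e₀, s)]`. [cite: HatcherAT2002, §1.3 p. 70] -/
@[simp] theorem assocFibreEquiv_assocMk (e₀ : E) (s : S) :
    assocFibreEquiv hf e₀ ⟨assocMk (e₀, s), rfl⟩ = s := by
  exact (assocFibreEquiv hf e₀).apply_symm_apply s

/-- The fibre equivalence on `[(g • e₀, s)]` is `g⁻¹ • s`. [cite: HatcherAT2002, §1.3 p. 70] -/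
theorem assocFibreEquiv_assocMk_smul (e₀ : E) (g : G) (s : S)
    (h : assocProj hf S (assocMk (g • e₀, s)) ∈ ({f e₀} : Set X)) :
    assocFibreEquiv hf e₀ ⟨assocMk (g • e₀, s), h⟩ = g⁻¹ • s := by
  have : (⟨assocMk (g • e₀, s), h⟩ : assocProj hf S ⁻¹' {f e₀}) = ⟨assocMk (e₀, g⁻¹ • s), rfl⟩ :=
    Subtype.ext (assocMk_smul_left g e₀ s)
  rw [this, assocFibreEquiv_assocMk]

end Proj

end Literature.Topology.CoveringSpaces

end
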